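import Summits.AtomisticToContinuum.HydrodynamicLimit.Theorems.OneFlightGossipEngineEquilibriumClampedCollisionalWindowLDStubMeasurability
import Summits.AtomisticToContinuum.HydrodynamicLimit.Theorems.OneFlightGossipEngineEnergyCurrentTailsLevelCensusPreCollisionFlux
import HarnessLib

/-!
# Measurability of tagged collision sums over an arbitrary window `(a, b]`
(crux `TwoClocks.TransferActivityTails`, stmt-AtomisticToContinuum-16624; line `Sketch` (idea `predictor-drift-doob`),
stub `stub_collisionSumMeasurable`, registered signature verbatim in
`Summit.AtomisticToContinuum.HydrodynamicLimit.Theorems.TransferActivityTailsTaggedSumMeasurable`)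

Support file (`--supports stmt-AtomisticToContinuum-16624`) in the vocabulary of
`Theorems/OneFlightGossipEngineEquilibriumClampedCollisionalWindowLDDefs` (`Flow`, `Phase`, `Rec`, `window`, `impulse`).
The line cuts the crux's window `(s, s + τ (N+1)^{-1/3}]` into blocks `(s + j w₁, s + (j+1) w₁]`; the transfer to the
abstract probability engine needs every block activity `z ↦ Σ_{collisions in (a, b]} 𝟙{c.fst = i} · impulse c`,
extended by `0` off the good set (which carries the local Gibbs law), to be measurable in the datum. The tree has this
for the windows `(0, window τ N]` (`ClampedTransferCoin.measurable_indicator_collisionSum_window`, coin decomposition);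
this file moves it to an arbitrary window:

* `collisionSum_Ioc_of_le` — for `b ≤ a` the window is empty and the collision sum vanishes;
* `window_mul_rpow` — `window (ℓ (N+1)^{1/3}) N = ℓ` (every length is a kinetic window);
* `measurable_indicator_collisionSum_Ioc` — for a MEASURABLE functional of the record that does not read the time
  stamp, `z ↦ Σ_{collisions in (a, b]} F`, extended by `0` off the good set, is measurable: by the window shift
  `EnergyCurrentTailsLevelCensus.collisionSum_Ioc_eq_collisionSum_flow` it is, on the good set, the `(0, b − a]`-sum
  along the orbit of `Φ_a z` (good again, `mapsTo_good`), i.e. the composition of the measurable window sum with the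
  measurable map `Φ_a`;
* `stub_collisionSumMeasurable` — the registered stub (tagged impulse, `ClampedTransferCoin.measurable_ite_fst_impulse`).

Hypothesis `0 < σ < 1/2` (hard-sphere regularity of the torus geometry at diameter `ε_N ≤ σ`). No new definitions.
prover-line-stmt-AtomisticToContinuum-16624-c6-0, 2026-08-17.
-/

noncomputable section

open MeasureTheory Set
open Literature.MathematicalPhysics.KineticTheory Literature.Analysis.FluidPDE
open Summit.AtomisticToContinuum.HydrodynamicLimit.Theorems.ClampedTransferCoin
  (Flow Phase Rec window impulse window_pos)

namespace Summit.AtomisticToContinuum.HydrodynamicLimit.Theorems.TransferActivityTailsTaggedSumMeasurable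

variable {σ : ℝ} {N : ℕ}

/-- For `b ≤ a` the window `(a, b]` is empty and every collision sum over it vanishes. -/
theorem collisionSum_Ioc_of_le {M : Type*} [AddCommMonoid M] (Φ : Flow σ N) {a b : ℝ} (hab : b ≤ a)
    (F : Rec N → M) (z : Phase N) : Φ.collisionSum (Set.Ioc a b) F z = 0 := by
  rw [HardSphereFlow.collisionSum_eq, collisionSum_eq_collisionPairSum, Ioc_eq_empty (not_lt.2 hab),
    collisionPairSum_empty]

/-- Every length `ℓ` is a kinetic window: `window (ℓ (N+1)^{1/3}) N = ℓ`. -/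
theorem window_mul_rpow (ℓ : ℝ) (N : ℕ) : window (ℓ * ((N : ℝ) + 1) ^ (1 / 3 : ℝ)) N = ℓ := by
  unfold window
  have hN : (0 : ℝ) < (N : ℝ) + 1 := by positivity
  rw [Real.rpow_neg hN.le, mul_assoc, mul_inv_cancel₀ (Real.rpow_pos_of_pos hN _).ne', mul_one]

/-- **Collision sums over an arbitrary window `(a, b]` of measurable, time-stamp-blind functionals of the record are
measurable in the datum** (extended by `0` off the good set): empty window if `b ≤ a`; otherwise the window shift to
`(0, b − a]` along the orbit of `Φ_a z` and `ClampedTransferCoin.measurable_indicator_collisionSum_window` with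
`τ := (b − a) (N+1)^{1/3}`. -/
theorem measurable_indicator_collisionSum_Ioc (hσ : 0 < σ) (hσ2 : σ < 1 / 2) (Φ : Flow σ N) (a b : ℝ)
    {F : Rec N → ℝ} (hF : Measurable F)
    (hFt : ∀ (w : Phase N) (t t' : ℝ) (k l : Fin (N + 1)),
      F (HardSphereCollisionRecord.ofConfig (Torus.geometry (Fin 3)) (hsDiameter σ N) w t k l) =
        F (HardSphereCollisionRecord.ofConfig (Torus.geometry (Fin 3)) (hsDiameter σ N) w t' k l)) :
    Measurable (Φ.good.indicator fun z => Φ.collisionSum (Set.Ioc a b) F z) := by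
  rcases le_or_gt b a with hab | hab
  · have heq : (Φ.good.indicator fun z => Φ.collisionSum (Set.Ioc a b) F z) = fun _ => 0 := by
      funext z
      rw [Set.indicator_apply_eq_zero]
      exact fun _ => collisionSum_Ioc_of_le Φ hab F z
    rw [heq]
    exact measurable_const
  · set τ : ℝ := (b - a) * ((N : ℝ) + 1) ^ (1 / 3 : ℝ)
    have hwin : window τ N = b - a := window_mul_rpow (b - a) N
    have heq : (Φ.good.indicator fun z => Φ.collisionSum (Set.Ioc a b) F z) =
        Φ.good.indicator ((Φ.good.indicator fun z => Φ.collisionSum (Set.Ioc 0 (window τ N)) F z) ∘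
          Φ.flow a) := by
      refine Set.indicator_congr fun z hz => ?_
      rw [Function.comp_apply, Set.indicator_of_mem (Φ.mapsTo_good a hz), hwin]
      exact EnergyCurrentTailsLevelCensus.collisionSum_Ioc_eq_collisionSum_flow Φ hz a b F hFt
    rw [heq]
    exact ((ClampedTransferCoin.measurable_indicator_collisionSum_window hσ hσ2 τ Φ hF).comp
      (Φ.measurable_flow a)).indicator Φ.measurableSet_good

/-- **STUB (measurability)** — the tagged impulse collision sum over `(a, b]`, extended by `0` off the good set, is
measurable in the datum (`0 < σ < 1/2`). -/
theorem stub_collisionSumMeasurable :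
    ∀ (σ : ℝ) (N : ℕ) (Φ : Flow σ N) (i : Fin (N + 1)) (a b : ℝ), 0 < σ → σ < 1 / 2 →
    Measurable (Φ.good.indicator fun z =>
      Φ.collisionSum (Set.Ioc a b) (fun c => if c.fst = i then impulse c else 0) z) :=
  fun _ _ Φ i a b hσ hσ2 => measurable_indicator_collisionSum_Ioc hσ hσ2 Φ a b
    (ClampedTransferCoin.measurable_ite_fst_impulse i) fun _ _ _ _ _ => rfl

end Summit.AtomisticToContinuum.HydrodynamicLimit.Theorems.TransferActivityTailsTaggedSumMeasurable

end
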